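import Literature.NumberTheory.Automorphic.GelbartJacquetAdjointLiftArchimedeanProofs
import Literature.NumberTheory.Automorphic.SatakeParamNeZeroProofs
import Literature.NumberTheory.Automorphic.KimExteriorSquareGL4ArchimedeanTwist
import HarnessLib

/-!
# `GelbartJacquetLiftArchimedean` (stmt-Langlands-15002): shape certificates for the typed conclusion

The item (verbatim the named fact `Literature.NumberTheory.Automorphic.GelbartJacquet_adjoint_lift_archimedean`,
Gelbart–Jacquet 1978, Thm. (9.3) (2)–(3) with Prop. (3.2)) asks, for a cuspidal `π` on `GL₂(𝔸_F)`, for a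
cuspidal `P` on `GL₃(𝔸_F)` with `P.1.HasSatakeParamAt v (adParams α)` whenever `π.1.HasSatakeParamAt v α`
(a.e. `v`) and `P.1.HasArchParameter (σ ↦ Ad₊ (χ σ))` whenever `π.1.HasArchParameter χ`, where
`Ad₊ χ = ((χ ×ˢ χ).map (p.1 - p.2)).erase 0`.  In the Borel–Jacquet datum model both target predicates carry
NECESSARY CONDITIONS that are theorems of the tree: a Satake parameter of a `GL₃` datum has exactly three
entries, all non-zero (`HasSatakeParamAt.card_eq`, `hasSatakeParamAt_ne_zero_holds`), and an archimedean
parameter of a `GL₃` datum has three entries at every complex embedding (`card_eq_of_hasArchParameter`).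
This file certifies, from the HYPOTHESES on `π` alone, that the multisets the item prescribes for `P` meet
these conditions — so the item is not refutable by a cardinality / vanishing slip of its normalisation
(the "erased `0`" and "erased `1`" of `Ad₊` and `adParams`): `adParams α = {x/y, y/x, 1}` has three non-zero
entries and `Ad₊ (χ σ)` has three entries.  Supporting lemmas for stmt-Langlands-15002 (no route decl is
asserted; the item itself is the printed theorem of Gelbart–Jacquet and stays conditional on the named fact).
-/

set_option linter.dupNamespace false

noncomputable section

namespace Summit.Langlands.Langlands.Theorems.GelbartJacquetLiftArchimedean

open scoped Classical MatrixGroups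
open Literature.NumberTheory.Automorphic IsDedekindDomain NumberField

variable {F : Type} [Field F] [NumberField F] {hF : isCompact_glFiniteIntegralLevel 2 F}

/-- **A Satake parameter of a `GL₂` datum is a pair of non-zero complex numbers**:
`π.HasSatakeParamAt v α` gives `α = {x, y}` with `x, y ≠ 0` (`card α = 2` is part of the predicate;
non-vanishing is Cartier's remark that `e₂(α) = xy` is the eigenvalue of the invertible central Hecke
operator, `hasSatakeParamAt_ne_zero_holds`). [cite: CartierCorvallis1979, §IV.2] -/
theorem exists_pair_of_hasSatakeParamAt {π : AutomorphicRepData (AutomorphyDatum.gl 2 F hF)}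
    {v : HeightOneSpectrum (𝓞 F)} {α : Multiset ℂ} (h : π.HasSatakeParamAt v α) :
    ∃ x y : ℂ, x ≠ 0 ∧ y ≠ 0 ∧ α = {x, y} := by
  obtain ⟨x, y, rfl⟩ := Multiset.card_eq_two.mp h.card_eq
  exact ⟨x, y, hasSatakeParamAt_ne_zero_holds h x (by simp), hasSatakeParamAt_ne_zero_holds h y (by simp),
    rfl⟩

/-- **Satake-side shape certificate.** If `α` is a Satake parameter of a `GL₂` datum then the adjoint
parameter `adParams α = {x/y, y/x, 1}` prescribed by the item for the lift has exactly three entries — the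
cardinality `HasSatakeParamAt` demands of a `GL₃` datum (Gelbart–Jacquet 1978, (3.5):
`t_{π,v} = Ad(t_{σ,v})`). [cite: GelbartJacquet1978, (3.5)] -/
theorem card_adParams_of_hasSatakeParamAt {π : AutomorphicRepData (AutomorphyDatum.gl 2 F hF)}
    {v : HeightOneSpectrum (𝓞 F)} {α : Multiset ℂ} (h : π.HasSatakeParamAt v α) :
    Multiset.card (adParams α) = 3 := by
  obtain ⟨x, y, hx, hy, rfl⟩ := exists_pair_of_hasSatakeParamAt h
  rw [adParams_pair hx hy]
  simp

/-- **Satake-side non-vanishing certificate.** If `α` is a Satake parameter of a `GL₂` datum then every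
entry of `adParams α = {x/y, y/x, 1}` is non-zero — the necessary condition
`hasSatakeParamAt_ne_zero` imposes on any `GL₃` datum `P` with `P.1.HasSatakeParamAt v (adParams α)`.
[cite: GelbartJacquet1978, (3.5)] [cite: CartierCorvallis1979, §IV.2] -/
theorem ne_zero_of_mem_adParams_of_hasSatakeParamAt {π : AutomorphicRepData (AutomorphyDatum.gl 2 F hF)}
    {v : HeightOneSpectrum (𝓞 F)} {α : Multiset ℂ} (h : π.HasSatakeParamAt v α) :
    ∀ a ∈ adParams α, a ≠ 0 := by
  obtain ⟨x, y, hx, hy, rfl⟩ := exists_pair_of_hasSatakeParamAt h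
  rw [adParams_pair hx hy]
  intro a ha
  simp only [Multiset.insert_eq_cons, Multiset.mem_cons, Multiset.mem_singleton] at ha
  rcases ha with rfl | rfl | rfl
  · exact mul_ne_zero hx (inv_ne_zero hy)
  · exact mul_ne_zero hy (inv_ne_zero hx)
  · exact one_ne_zero

/-- **The adjoint Satake parameter has trivial determinant**: `∏ adParams α = 1` for a Satake parameter
`α = {x, y}` of a `GL₂` datum (the lift has trivial central character, Gelbart–Jacquet 1978, Def. 3.1.3 (i);
at `v`: `(x/y) (y/x) 1 = 1`). [cite: GelbartJacquet1978, Def. 3.1.3 (i) and (3.5)] -/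
theorem prod_adParams_of_hasSatakeParamAt {π : AutomorphicRepData (AutomorphyDatum.gl 2 F hF)}
    {v : HeightOneSpectrum (𝓞 F)} {α : Multiset ℂ} (h : π.HasSatakeParamAt v α) :
    (adParams α).prod = 1 := by
  obtain ⟨x, y, hx, hy, rfl⟩ := exists_pair_of_hasSatakeParamAt h
  rw [adParams_pair hx hy]
  simp only [Multiset.insert_eq_cons, Multiset.prod_cons, Multiset.prod_singleton, mul_one]
  field_simp

/-- **Archimedean-side shape certificate.** If `χ` is an archimedean parameter of a `GL₂` datum then at
every complex embedding `σ` the adjoint parameter `Ad₊ (χ σ) = ((χ σ ×ˢ χ σ).map (p.1 - p.2)).erase 0`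
prescribed by the item has exactly three entries — the cardinality `HasArchParameter` demands of a `GL₃`
datum (Gelbart–Jacquet 1978, Prop. 3.2, (3.2.2): `deg λ = 3`). [cite: GelbartJacquet1978, Prop. 3.2, (3.2.2)] -/
theorem card_adArch_of_hasArchParameter {π : AutomorphicRepData (AutomorphyDatum.gl 2 F hF)}
    {χ : (F →+* ℂ) → Multiset ℂ} (h : π.HasArchParameter χ) (σ : F →+* ℂ) :
    Multiset.card ((((χ σ) ×ˢ (χ σ)).map fun p : ℂ × ℂ => p.1 - p.2).erase 0) = 3 :=
  card_adArch_of_card_eq_two (AutomorphicRepData.card_eq_of_hasArchParameter h σ)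

end Summit.Langlands.Langlands.Theorems.GelbartJacquetLiftArchimedean

end

/-!
## Quantifier-shape certificate: "one `P` for every `χ`" is not a failure mode

The item places `∀ χ, π.1.HasArchParameter χ → P.1.HasArchParameter (Ad₊ χ)` INSIDE `∃ P` — one lift
serving every archimedean parameter of `π` — which the route's risk note lists as a possible typing
slip ("one P for every χ").  It is not: an automorphic representation datum has AT MOST ONE
archimedean parameter (`AutomorphicRepData.hasArchParameter_unique`, Harish-Chandra, a theorem of the
tree), so the `∃ P ∀ χ` form is EQUIVALENT to the conjunction of the Satake-only lift with the
per-parameter form `∀ χ, π.1.HasArchParameter χ → ∃ P, …` (`fact_iff_adjoint_lift_and_pointwise`).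
Whoever discharges the named fact may therefore produce the lift once, for "the" parameter of `π`.
-/

noncomputable section

namespace Summit.Langlands.Langlands.Theorems.GelbartJacquetLiftArchimedean

open scoped Classical MatrixGroups
open Literature.NumberTheory.Automorphic IsDedekindDomain NumberField

/-- **`∃ P ∀ χ` from `∀ χ ∃ P`, by uniqueness of the archimedean parameter.** For an automorphic
representation datum `π` of `GL_n(𝔸_K)`, any type of candidates `β` and any predicates `A` (on
candidates) and `B` (on a candidate and a parameter): if some candidate satisfies `A`, and for every
archimedean parameter `χ` of `π` some candidate satisfies `A` and `B · χ`, then ONE candidate satisfies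
`A` and `B · χ` for EVERY archimedean parameter `χ` of `π` — because `π` has at most one
(`AutomorphicRepData.hasArchParameter_unique`; Clozel 1990, §3.3; Knapp 2002, Thm. 5.44).
[cite: Clozel1990, §3.3] -/
theorem exists_forall_hasArchParameter_of_pointwise {n : ℕ} {K : Type} [Field K] [NumberField K]
    {hcpt : isCompact_glFiniteIntegralLevel n K} (π : AutomorphicRepData (AutomorphyDatum.gl n K hcpt))
    {β : Sort*} {A : β → Prop} {B : β → ((K →+* ℂ) → Multiset ℂ) → Prop}
    (h0 : ∃ P, A P) (h1 : ∀ χ, π.HasArchParameter χ → ∃ P, A P ∧ B P χ) :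
    ∃ P, A P ∧ ∀ χ, π.HasArchParameter χ → B P χ := by
  by_cases hex : ∃ χ₀, π.HasArchParameter χ₀
  · obtain ⟨χ₀, hχ₀⟩ := hex
    obtain ⟨P, hA, hB⟩ := h1 χ₀ hχ₀
    refine ⟨P, hA, fun χ hχ => ?_⟩
    obtain rfl : χ = χ₀ := π.hasArchParameter_unique hχ hχ₀
    exact hB
  · obtain ⟨P, hA⟩ := h0
    exact ⟨P, hA, fun χ hχ => (hex ⟨χ, hχ⟩).elim⟩

/-- **The converse (trivial) direction**: one candidate serving every archimedean parameter serves
each of them. [folklore] -/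
theorem pointwise_of_exists_forall_hasArchParameter {n : ℕ} {K : Type} [Field K] [NumberField K]
    {hcpt : isCompact_glFiniteIntegralLevel n K} (π : AutomorphicRepData (AutomorphyDatum.gl n K hcpt))
    {β : Sort*} {A : β → Prop} {B : β → ((K →+* ℂ) → Multiset ℂ) → Prop}
    (h : ∃ P, A P ∧ ∀ χ, π.HasArchParameter χ → B P χ) :
    (∃ P, A P) ∧ ∀ χ, π.HasArchParameter χ → ∃ P, A P ∧ B P χ := by
  obtain ⟨P, hA, hB⟩ := h
  exact ⟨⟨P, hA⟩, fun χ hχ => ⟨P, hA, hB χ hχ⟩⟩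

/-- **Quantifier-shape certificate for the item.** The named fact the item restates verbatim,
`GelbartJacquet_adjoint_lift_archimedean` (Gelbart–Jacquet 1978, Thm. (9.3) (2)–(3) with Prop. 3.2:
ONE cuspidal lift `P` with `t_{P,v} = Ad(t_{π,v})` a.e. and archimedean parameter `Ad₊ χ` for every
archimedean parameter `χ` of `π`), is EQUIVALENT to the conjunction of the tree's Satake-only lift
`GelbartJacquet_adjoint_lift` (Gelbart 1997, Thm. 5.3.2) with the per-parameter archimedean clause
(for each archimedean parameter `χ` of `π` SOME cuspidal lift with the Satake clause has archimedean
parameter `Ad₊ χ`): `→` by projection, `←` by `exists_forall_hasArchParameter_of_pointwise`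
(uniqueness of the archimedean parameter). [cite: GelbartJacquet1978, Thm. (9.3) (2)–(3) and Prop. 3.2]
[cite: Gelbart1997, Thm. 5.3.2] -/
theorem fact_iff_adjoint_lift_and_pointwise :
    GelbartJacquet_adjoint_lift_archimedean ↔
      GelbartJacquet_adjoint_lift ∧
      ∀ (F : Type) [Field F] [NumberField F] (hF : isCompact_glFiniteIntegralLevel 2 F)
        (hF3 : isCompact_glFiniteIntegralLevel 3 F) (π : CuspidalAutomorphicRepData 2 F hF),
        (∀ (K : Type) [Field K] [NumberField K] [Algebra F K], Module.finrank F K = 2 →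
            ¬ IsQuadraticSelfTwistAE K π.1) →
        ∀ χ : (F →+* ℂ) → Multiset ℂ, π.1.HasArchParameter χ →
          ∃ P : CuspidalAutomorphicRepData 3 F hF3,
            (∀ᶠ v : HeightOneSpectrum (𝓞 F) in Filter.cofinite, ∀ α : Multiset ℂ,
              π.1.HasSatakeParamAt v α → P.1.HasSatakeParamAt v (adParams α)) ∧
            P.1.HasArchParameter fun σ => (((χ σ) ×ˢ (χ σ)).map fun p => p.1 - p.2).erase 0 := by
  constructor
  · intro h
    refine ⟨h.adjoint_lift, fun F _ _ hF hF3 π hπ => ?_⟩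
    exact (pointwise_of_exists_forall_hasArchParameter π.1 (h F hF hF3 π hπ)).2
  · rintro ⟨hsat, harch⟩ F _ _ hF hF3 π hπ
    exact exists_forall_hasArchParameter_of_pointwise π.1 (hsat F hF hF3 π hπ) (harch F hF hF3 π hπ)

end Summit.Langlands.Langlands.Theorems.GelbartJacquetLiftArchimedean

end
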